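import Mathlib
import Summits.Ventures.PercRepro2.TypedBundleTower
import Summits.Ventures.PercRepro2.TypedSixRung

/-!
# The domain of record at `|F| ≥ 7` (blind cell PercRepro2, p2 g6, 2026-08-25; sub-claim S1 — the
rung `|F| = 6` composed with every subtraction of the tower)

With `sixRung_holds` (TypedSixRung.lean) the `|F| = 6` instances of the domain of record
`ResidualCoreNHatCTBRASUDO` (p3's TypedBundleTower.lean) are closed, so the domain drops to
`|F| ≥ 7`, in the `by_cases` pattern of every layer:

* **`ResidualCoreNHatCTBRASUDO7 := ResidualCoreNHatCTBRASUDO ∧ 7 ≤ |F|`**,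
  **`HCov_all_of_residualCoreNHatCTBRASUDO7_all`** — UNCONDITIONAL;
* the flat form **`FlatDomain7_all`** (the eleven conditions of `FlatDomain_all` and `7 ≤ F.card`),
  **`HCov_all_of_flat7_all`**.

Own code; standard axioms.
-/

namespace Summit.Ventures.PercRepro2

open UnionCluster

namespace CovForm

namespace TypedRed

section CoreSeven

variable {V : Type*} {E : Type*} [DecidableEq V] [Fintype E] [DecidableEq E]

/-- **The domain of record at `|F| ≥ 7`.** -/
structure ResidualCoreNHatCTBRASUDO7 (ends : E → Sym2 V) (o a₁ a₂ a₃ b : V) (F : Finset E) :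
    Prop where
  coreNHatCTBRASUDO : ResidualCoreNHatCTBRASUDO ends o a₁ a₂ a₃ b F
  seven_le : 7 ≤ F.card

omit [DecidableEq V] [Fintype E] in
/-- The core of a domain-of-record instance. -/
theorem ResidualCoreNHatCTBRASUDO.core {ends : E → Sym2 V} {o a₁ a₂ a₃ b : V} {F : Finset E}
    (h : ResidualCoreNHatCTBRASUDO ends o a₁ a₂ a₃ b F) : ResidualCore ends o a₁ a₂ a₃ b F :=
  ((ResidualCoreNHatCTBRASUDO_iff ends o a₁ a₂ a₃ b F).1 h).1

omit [DecidableEq V] [Fintype E] in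
/-- A core instance has six or at least seven typed edges. -/
theorem ResidualCore.card_eq_six_or_seven_le {ends : E → Sym2 V} {o a₁ a₂ a₃ b : V} {F : Finset E}
    (h : ResidualCore ends o a₁ a₂ a₃ b F) : F.card = 6 ∨ 7 ≤ F.card := by
  have := h.residualConR.residualCon.residual.six_le
  omega

end CoreSeven

section ClosureSeven

variable (R : Type*) [Field R] [LinearOrder R] [IsStrictOrderedRing R]

/-- **Row 2′TRI on `ResidualCoreNHatCTBRASUDO7`, over every finite graph.** -/
def ResidualCoreNHatCTBRASUDO7_all : Prop :=
  ∀ (V E : Type) [Fintype V] [DecidableEq V] [Fintype E] [DecidableEq E]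
    (ends : E → Sym2 V) (o a₁ a₂ a₃ b : V) (F : Finset E) (τ : E → ℕ),
    (∀ e ∈ F, τ e = 1 ∨ τ e = 2) → ResidualCoreNHatCTBRASUDO7 ends o a₁ a₂ a₃ b F →
      0 ≤ typedCount F (fun _ => false) τ
        (K3 ends o a₁ a₂ a₃ b : Config E → Config E → Config E → R)

/-- **THE CRUX OF RECORD FROM (TRI) ON THE DOMAIN OF RECORD AT `|F| ≥ 7`** — unconditional (the
tower and the rung `|F| = 6`). -/
theorem HCov_all_of_residualCoreNHatCTBRASUDO7_all (hc : ResidualCoreNHatCTBRASUDO7_all R) :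
    HCov_all R := by
  refine HCov_all_of_residualCoreNHatCTBRASUDO_all R ?_
  intro V E _ _ _ _ ends o a₁ a₂ a₃ b F τ hτ hdom
  rcases hdom.core.card_eq_six_or_seven_le with h6 | h7
  · exact sixRung_holds R V E ends o a₁ a₂ a₃ b F τ
      hdom.core.residualConR.residualCon.residual.reduced hdom.core.marks h6 hτ
  · exact hc V E ends o a₁ a₂ a₃ b F τ hτ ⟨hdom, h7⟩

/-- **Row 2′TRI on the flat domain at `|F| ≥ 7`, over every finite graph.** -/
def FlatDomain7_all : Prop :=
  ∀ (V E : Type) [Fintype V] [DecidableEq V] [Fintype E] [DecidableEq E]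
    (ends : E → Sym2 V) (o a₁ a₂ a₃ b : V) (F : Finset E) (τ : E → ℕ),
    (∀ e ∈ F, τ e = 1 ∨ τ e = 2) →
    ResidualCore ends o a₁ a₂ a₃ b F →
    ¬ Hats ends o a₁ a₂ a₃ b F →
    ¬ HasRootCut ends o a₁ a₂ a₃ b F →
    ¬ HasTwoTerminalPart ends o a₁ a₂ a₃ b F →
    ¬ HasRootBundle ends o a₁ a₂ a₃ b F →
    ¬ RootBridge.HasCutRoots ends o a₁ a₂ a₃ b F →
    ¬ RootBridge.HasCutRootsA3 ends o a₁ a₂ a₃ b F →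
    ¬ OneStar ends o a₁ a₂ a₃ b F →
    ¬ RootBridge.MildInst ends o a₁ a₂ a₃ b F (fun _ => false) →
    o ≠ b →
    ¬ RootBridge.OBehindA3 ends o a₁ a₂ a₃ F (fun _ => false) →
    7 ≤ F.card →
      0 ≤ typedCount F (fun _ => false) τ
        (K3 ends o a₁ a₂ a₃ b : Config E → Config E → Config E → R)

/-- **THE CRUX OF RECORD FROM (TRI) ON THE FLAT DOMAIN AT `|F| ≥ 7`** — the sentence of record in
one statement, twelve conditions. -/
theorem HCov_all_of_flat7_all (hc : FlatDomain7_all R) : HCov_all R := by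
  refine HCov_all_of_residualCoreNHatCTBRASUDO7_all R ?_
  intro V E _ _ _ _ ends o a₁ a₂ a₃ b F τ hτ hdom
  obtain ⟨h0, h1, h2, h3, h4, h5, h6, h7, h8, h9, h10⟩ :=
    (ResidualCoreNHatCTBRASUDO_iff ends o a₁ a₂ a₃ b F).1 hdom.coreNHatCTBRASUDO
  exact hc V E ends o a₁ a₂ a₃ b F τ hτ h0 h1 h2 h3 h4 h5 h6 h7 h8 h9 h10 hdom.seven_le

end ClosureSeven

end TypedRed

end CovForm

end Summit.Ventures.PercRepro2
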